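import Literature.AlgebraicGeometry.Motives.HodgeLieRankThreeSpanC
import Literature.AlgebraicGeometry.Motives.HodgeThetaAnnihilatorLieAlgebra
import HarnessLib

/-!
# The `Θ`-subalgebra theorem in Hodge-group rank three: a rational Lie algebra inside `𝔰𝔭_{End_Hdg}(V, ψ)` containing `Θ`
# after complexification contains `Lie Hg ⊗ ℂ ≅ 𝔰𝔩₂`; rational tensors killed by `Θ` are killed by `Lie Hg ⊗ ℂ`
# (Deligne LNM 900 I §3; Murty 1984 / Moonen–Zarhin 1999 §2, Lie step)

Family `hodge`, layer `Literature/AlgebraicGeometry/Motives` (abstract polarizable `ℚ`-Hodge structures; no geometry).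
Written for the cell `pub-hodgecm2` (COR-CM), seat `b27`, count-neutral lane MT-RANK-FOUR-DIVISORS (sequel of the
MT-rank ladder MT-RANK-FOUR: `HodgeLieRankLowerBound`, `HodgeLieWeightOneSl2Triple`, `HodgeLieWeightOneRankThree`);
UNCONDITIONAL linear algebra of Hodge structures, no step towards a summit statement.  It is the rank-three analogue
of the tree's real-multiplication theorem `HodgeStructure.ThetaSubalgebra.mem_spanC_of_mapsTo_of_skew` /
THEOREM L `HodgeStructure.wordDerAt_eq_zero_of_mapsTo_of_skew` (`Motives/HodgeThetaSubalgebraRealPlacesSl2`,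
`Motives/HodgeThetaAnnihilatorLieAlgebra`, cell `pub-hodge-ring2`), whose descent machinery (`spanC`, `annLie`,
`mem_spanC_annLie`, `wordDerAt_eq_zero_of_mem_spanC_annLie`) it reuses BY NAME; §0–§1 (generic `spanC` facts and
`𝔞_ℂ ⊆ ℂΘ′ ⊕ ℂE ⊕ ℂF`) are the companion file `Motives/HodgeLieRankThreeSpanC`.

SETTING.  `H` an effective polarizable `ℚ`-Hodge structure of weight `1` on a finite-dimensional `V`, `ψ` a
polarization, `dim_ℚ Lie Hg(H) ≤ 3` and `Lie Hg(H) ⊄ End_Hdg(V)` — the Hodge structure `H¹` of a complex abelian variety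
NOT of CM type with `dim MT(H¹) ≤ 4` (Moonen–Zarhin 1999 §2: Type I(1) `Hg = SL₂`, Type II(1) `Hg = SL₁(D)`; the tree's
`Summits/HodgeConjecture/CorCM/MumfordTateRankFour`).  In a graded basis `e` of `V_ℂ` with grading projector
`P` onto `V^{1,0}` and any `X ∈ Lie Hg ∖ End_Hdg`: `Lie Hg ⊗ ℂ = ℂΘ′ ⊕ ℂE ⊕ ℂF`, `Θ′ = 2P − 1`, `E = P X_ℂ (1 − P)`,
`F = (1 − P) X_ℂ P`, `E F = α P`, `F E = α (1 − P)`, `α ≠ 0`, and `End_Hdg(V) ⊗ ℂ` is the commutant of `{P, E, F}`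
(`exists_coeffs_of_mem_hodgeLieC`, `exists_projE_mul_projF_eq_smul`, `mem_span_endAlg_iff_commute`).

MAIN RESULTS (all proved; no definition, no named fact, D-0026):
* §2 **`HodgeStructure.hodgeLieC_le_spanC_of_theta_mem`** — for a bracket-closed rational subspace `𝔞 ⊆ End_ℚ V` of
  operators commuting with `End_Hdg(V)` and `ψ`-skew whose complex span `𝔞_ℂ` contains a Hodge operator `Θ`
  (`= 2p − 1` on `V^{p,1-p}`): `𝔞_ℂ ⊇ Lie Hg ⊗ ℂ`.  Steps: `𝔞_ℂ ⊆ ℂΘ′ ⊕ ℂE ⊕ ℂF`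
  (`exists_coeffs_of_mem_spanC_of_commute_of_skew`, file `HodgeLieRankThreeSpanC`); a rational `X′ ∈ 𝔞` with
  `X′_ℂ ∈ ℂΘ′` is a central Hodge endomorphism, hence a rational scalar (`exists_eq_smul_one_of_mem_center_endAlg`),
  hence `0`; two brackets with `Θ′ ∈ 𝔞_ℂ` (`[Θ′, E] = 2E`, `[Θ′, F] = −2F`) and complex conjugation `E ↔ F`
  (`conj_projE_conj_apply`, `conjOp_mem_spanC`) produce `E, F ∈ 𝔞_ℂ`.
* §3 **THEOREM L′ `HodgeStructure.wordDerAt_eq_zero_of_mem_hodgeLieC_of_rankThree`** — a RATIONAL coefficient tensor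
  `q` (letters: slots `Fin m` × a `ℚ`-basis of `V`) killed, slice by slice, by the matrix of `Θ` is killed by the matrix
  of every `Y ∈ Lie Hg(H) ⊗ ℂ` (Deligne, LNM 900 I §3, proof of Prop. 3.4: the Lie algebra of the `ℚ`-group fixing a
  rational tensor is defined over `ℚ` and contains `Θ`; here without algebraic groups, through the tree's `annLie`,
  `mem_spanC_annLie`, `wordDerAt_eq_zero_of_mem_spanC_annLie`).  This is the Lie-algebra half of Murty's theorem
  `Hdg(A^k) = Div(A^k)` for `rank Hg(A)_ℂ = rdim A = 1` (Gordon's survey Thm. 7.5 (3) ⇒ (1), §7.3.2), in the shape of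
  the tree's THEOREM L (`wordDerAt_eq_zero_of_mapsTo_of_skew`, the real-multiplication case).

## References

* [Deligne1982HodgeCycles] P. Deligne, *Hodge cycles on abelian varieties*, LNM 900 (1982), I §3 (proof of Prop. 3.4).
* [Gordon1997] B. B. Gordon, *A survey of the Hodge conjecture for abelian varieties*, App. B of Lewis, CRM Monogr.
  Ser. 10 (1999) = arXiv:alg-geom/9709030 (held `paper:arxiv-alg-geom_9709030`), §7.3.2 (Murty: type (H), QM surfaces),
  Thm. 7.5 (Murty 1984 [B.82] / Hazama 1984 [B.47]: `rank Hg(A)_ℂ = rdim A ⟺ Hdg(A^k) = Div(A^k) ∀ k`).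
* [MoonenZarhin1999LowDim] B. Moonen, Yu. Zarhin, *Hodge classes on abelian varieties of low dimension*, Math. Ann.
  315 (1999) 711–733, §2 (2.1)–(2.2) (Types I(1), II(1)).
* [DeligneHodgeII1971] P. Deligne, *Théorie de Hodge II*, Publ. Math. IHÉS 40 (1971), 2.1.4 (real structure).
* [Huybrechts2016K3] D. Huybrechts, *Lectures on K3 Surfaces* (2016), §3.3.4 (commutant of the Hodge group).
* [FultonHarris1991] W. Fulton, J. Harris, *Representation Theory*, GTM 129 (1991), Lecture 11 (§11.1).
-/

noncomputable section

open scoped TensorProduct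

namespace Literature.AlgebraicGeometry.Motives

namespace HodgeStructure

open Literature.RepresentationTheory.GeneralLinear Literature.NumberTheory.DiophantineGeometry

universe u

variable {V : Type u} [AddCommGroup V] [Module ℚ V] [Module.Finite ℚ V] [HodgeTensorFacts.{u, u}] {n : ℤ}
  {S : Type u} [Fintype S] [DecidableEq S] {deg : S → ℤ}

/-! ### §2 A bracket-closed `𝔞` with `Θ ∈ 𝔞_ℂ` contains `Lie Hg ⊗ ℂ` -/

/-- **The `Θ`-subalgebra theorem in Hodge-group rank three.**  Let `H` be an effective polarizable `ℚ`-Hodge structure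
of weight `1` with `dim_ℚ Lie Hg(H) ≤ 3` and `Lie Hg(H) ⊄ End_Hdg(V)` (so `Lie Hg ⊗ ℂ = ℂΘ′ ⊕ ℂE ⊕ ℂF ≅ 𝔰𝔩₂`), and let
`𝔞 ⊆ End_ℚ(V)` be a `ℚ`-subspace closed under the commutator whose elements commute with `End_Hdg(V)` and are skew
for the polarization `ψ`.  If the complex span `𝔞_ℂ` contains a Hodge operator `Θ` (`= 2p − 1` on `V^{p,1-p}`), then
`𝔞_ℂ ⊇ Lie Hg ⊗ ℂ`.  PROOF (Deligne, LNM 900 I §3, proof of 3.4, Lie-algebra form; Moonen–Zarhin §2 Type I(1)/II(1)):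
`𝔞_ℂ ⊆ ℂΘ′ ⊕ ℂE ⊕ ℂF` (`exists_coeffs_of_mem_spanC_of_commute_of_skew`); a rational `X′ ∈ 𝔞` with `X′_ℂ ∈ ℂΘ′` is a
central Hodge endomorphism, hence a rational scalar (`exists_eq_smul_one_of_mem_center_endAlg`), hence `0` — so some
`X′ ∈ 𝔞` has `X′_ℂ = c₀Θ′ + c₁E + c₂F` with `(c₁, c₂) ≠ 0`; bracketing twice with `Θ′ ∈ 𝔞_ℂ` (`[Θ′,E] = 2E`,
`[Θ′,F] = −2F`) isolates `c₁E` and `c₂F`; and `𝔞_ℂ` is stable under `Y ↦ conj ∘ Y ∘ conj`, which exchanges `E` and `F`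
(`conj_projE_conj_apply`), so both `E, F ∈ 𝔞_ℂ`. [cite: Deligne1982HodgeCycles, I §3 (proof of Prop. 3.4)]
[cite: MoonenZarhin1999LowDim, §2] -/
theorem hodgeLieC_le_spanC_of_theta_mem (H : HodgeStructure V n) (ψ : H.Polarization) (hn : n = 1)
    (hH : H.IsEffective) (hne : ¬ H.hodgeLie ≤ Subalgebra.toSubmodule H.endAlg)
    (h3 : Module.finrank ℚ H.hodgeLie ≤ 3) {𝔞 : Submodule ℚ (Module.End ℚ V)}
    (hbr : ∀ X ∈ 𝔞, ∀ Y ∈ 𝔞, X * Y - Y * X ∈ 𝔞)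
    (hcomm : ∀ X' ∈ 𝔞, ∀ a : H.endAlg, X' * (a : Module.End ℚ V) = a * X')
    (hskew : ∀ X' ∈ 𝔞, ∀ v w, ψ.form (X' v) w + ψ.form v (X' w) = 0)
    {Θ : Module.End ℂ (ℂ ⊗[ℚ] V)} (hΘ : ∀ p, ∀ x ∈ H.piece p (n - p), Θ x = ((2 * p - n : ℤ) : ℂ) • x)
    (hΘ𝔞 : Θ ∈ spanC 𝔞) : H.hodgeLieC ≤ spanC 𝔞 := by
  classical
  obtain ⟨X, hX, hXE⟩ := SetLike.not_le_iff_exists.1 hne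
  rw [Subalgebra.mem_toSubmodule] at hXE
  obtain ⟨S, deg, e, hF, hFc⟩ := exists_basis_F_eq_span H
  haveI : Fintype S := FiniteDimensional.fintypeBasisIndex e
  have hdeg : ∀ σ, deg σ = 0 ∨ deg σ = 1 := fun σ => by
    have h := hH.deg_mem_Icc_of_graded e hF hFc σ
    rw [hn] at h
    omega
  obtain ⟨hE0, hF0⟩ := projE_ne_zero_of_not_mem_endAlg H hn e hF hFc hdeg hXE
  have hcoef := fun {Z : Module.End ℂ (ℂ ⊗[ℚ] V)} (hZ : Z ∈ spanC 𝔞) =>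
    exists_coeffs_of_mem_spanC_of_commute_of_skew H ψ hn hH e hF hFc hX hXE h3 hcomm hskew hZ
  have hspan := fun {Z : Module.End ℂ (ℂ ⊗[ℚ] V)} (hZ : Z ∈ H.hodgeLieC) =>
    exists_coeffs_of_mem_hodgeLieC H hn e hF hFc hdeg hX hXE h3 hZ
  -- nontriviality of `V` (there is a basis vector)
  obtain ⟨σ₁, hσ₁⟩ : ∃ σ, deg σ = 1 := by
    by_contra h
    push Not at h
    apply hE0
    have hP0 : gradingEnd e deg = 0 := e.ext fun σ => by
      rw [gradingEnd_apply_basis, LinearMap.zero_apply]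
      rcases hdeg σ with h0 | h1
      · rw [h0, Int.cast_zero, zero_smul]
      · exact absurd h1 (h σ)
    rw [hP0, zero_mul, zero_mul]
  obtain ⟨σ₀, hσ₀⟩ : ∃ σ, deg σ = 0 := by
    by_contra h
    push Not at h
    apply hE0
    have hP1 : gradingEnd e deg = 1 := e.ext fun σ => by
      rw [gradingEnd_apply_basis, Module.End.one_apply]
      rcases hdeg σ with h0 | h1
      · exact absurd h0 (h σ)
      · rw [h1, Int.cast_one, one_smul]
    rw [hP1, sub_self, mul_zero]
  haveI : Nontrivial V := by
    by_contra hV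
    rw [not_nontrivial_iff_subsingleton] at hV
    haveI := hV
    haveI : Subsingleton (ℂ ⊗[ℚ] V) := inferInstance
    exact e.ne_zero σ₁ (Subsingleton.elim _ _)
  subst hn
  set P := gradingEnd e deg with hP
  set Y := X.baseChange ℂ with hY
  set E := P * Y * (1 - P) with hEdef
  set F := (1 - P) * Y * P with hFdef
  have hPP : P * P = P := gradingEnd_mul_gradingEnd_of_deg e hdeg
  have hPE : P * E = E := by rw [hEdef, ← mul_assoc, ← mul_assoc, hPP]
  have hEP : E * P = 0 := by rw [hEdef, mul_assoc (P * Y) (1 - P) P, sub_mul, one_mul, hPP, sub_self, mul_zero]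
  have hPF : P * F = 0 := by
    rw [hFdef, mul_assoc (1 - P) Y P, ← mul_assoc P (1 - P) (Y * P), mul_sub, mul_one, hPP, sub_self, zero_mul]
  have hFP : F * P = F := by rw [hFdef, mul_assoc ((1 - P) * Y) P P, hPP]
  -- `Θ = Θ′ := 2P − 1`
  have hΘeq : Θ = (2 : ℂ) • P - 1 := by
    refine e.ext fun σ => ?_
    rw [apply_basis_eq_of_forall_piece H e hF hFc (f := fun d : ℤ => ((2 * d - 1 : ℤ) : ℂ)) hΘ σ,
      LinearMap.sub_apply, LinearMap.smul_apply, Module.End.one_apply, hP, gradingEnd_apply_basis, smul_smul]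
    rw [show ((2 * deg σ - 1 : ℤ) : ℂ) = 2 * (deg σ : ℂ) - 1 by push_cast; ring, sub_smul, one_smul]
  -- identities for `Θ′`
  have hbrE : ((2 : ℂ) • P - 1) * E - E * ((2 : ℂ) • P - 1) = (2 : ℂ) • E := by
    rw [sub_mul, mul_sub, smul_mul_assoc, mul_smul_comm, hPE, hEP, one_mul, mul_one, smul_zero]
    module
  have hbrF : ((2 : ℂ) • P - 1) * F - F * ((2 : ℂ) • P - 1) = -((2 : ℂ) • F) := by
    rw [sub_mul, mul_sub, smul_mul_assoc, mul_smul_comm, hPF, hFP, one_mul, mul_one, smul_zero]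
    module
  have hPΘ : P * ((2 : ℂ) • P - 1) = P := by
    rw [mul_sub, mul_smul_comm, hPP, mul_one, two_smul, add_sub_cancel_right]
  have hΘP : ((2 : ℂ) • P - 1) * P = P := by
    rw [sub_mul, smul_mul_assoc, hPP, one_mul, two_smul, add_sub_cancel_right]
  have hP1P : P * (1 - P) = 0 := by rw [mul_sub, mul_one, hPP, sub_self]
  have h1PP : (1 - P) * P = 0 := by rw [sub_mul, one_mul, hPP, sub_self]
  have hΘ1 : ((2 : ℂ) • P - 1) (e σ₁) = e σ₁ := by
    rw [LinearMap.sub_apply, LinearMap.smul_apply, Module.End.one_apply, hP, gradingEnd_apply_basis, hσ₁,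
      Int.cast_one, one_smul, two_smul, add_sub_cancel_right]
  have hΘ0 : ((2 : ℂ) • P - 1) (e σ₀) = -e σ₀ := by
    rw [LinearMap.sub_apply, LinearMap.smul_apply, Module.End.one_apply, hP, gradingEnd_apply_basis, hσ₀,
      Int.cast_zero, zero_smul, smul_zero, zero_sub]
  set Θ' : Module.End ℂ (ℂ ⊗[ℚ] V) := (2 : ℂ) • P - 1 with hΘ'def
  have hΘ'𝔞 : Θ' ∈ spanC 𝔞 := hΘeq ▸ hΘ𝔞
  -- `ad Θ′` on `ℂΘ′ ⊕ ℂE ⊕ ℂF`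
  have had : ∀ a b c : ℂ, Θ' * (a • Θ' + b • E + c • F) - (a • Θ' + b • E + c • F) * Θ' =
      (2 * b) • E - (2 * c) • F := by
    intro a b c
    have h : Θ' * (a • Θ' + b • E + c • F) - (a • Θ' + b • E + c • F) * Θ' =
        b • (Θ' * E - E * Θ') + c • (Θ' * F - F * Θ') := by
      simp only [mul_add, add_mul, mul_smul_comm, smul_mul_assoc, smul_sub]
      abel
    rw [h, hbrE, hbrF, smul_neg, smul_smul, smul_smul, ← sub_eq_add_neg, mul_comm b 2, mul_comm c 2]
  -- (1) every `X′ ∈ 𝔞` with `X′_ℂ ∈ ℂΘ′` vanishes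
  have hzero : ∀ X' ∈ 𝔞, ∀ c₀ : ℂ, X'.baseChange ℂ = c₀ • Θ' → X' = 0 := by
    intro X' hX' c₀ hc₀
    -- `X′` is a Hodge endomorphism: both off-diagonal blocks vanish
    have hE' : P * X'.baseChange ℂ * (1 - P) = 0 := by
      rw [hc₀, mul_smul_comm, smul_mul_assoc, hPΘ, hP1P, smul_zero]
    have hF' : (1 - P) * X'.baseChange ℂ * P = 0 := by
      rw [hc₀, mul_smul_comm, smul_mul_assoc, mul_assoc, hΘP, h1PP, smul_zero]
    have hX'E : X' ∈ H.endAlg := mem_endAlg_of_projE_eq_zero H e hF hdeg hE' hF'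
    obtain ⟨q, hq⟩ := exists_eq_smul_one_of_mem_center_endAlg H ψ rfl hH hne h3 hX'E
      (fun a ha => hcomm X' hX' ⟨a, ha⟩)
    -- `q • 1 = c₀ • Θ′`: evaluate on `e σ₁` (eigenvalue `1`) and `e σ₀` (eigenvalue `-1`)
    have hqv : ∀ v, (X'.baseChange ℂ) v = (q : ℂ) • v := fun v => by
      rw [hq, LinearMap.baseChange_smul, Module.End.one_eq_id, LinearMap.baseChange_id, LinearMap.smul_apply,
        LinearMap.id_apply, ← algebraMap_smul ℂ q v, eq_ratCast]
    have hc1 : (X'.baseChange ℂ) (e σ₁) = c₀ • e σ₁ := by rw [hc₀, LinearMap.smul_apply, hΘ1]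
    have hc0 : (X'.baseChange ℂ) (e σ₀) = (-c₀) • e σ₀ := by rw [hc₀, LinearMap.smul_apply, hΘ0, smul_neg, neg_smul]
    have h1 : (q : ℂ) = c₀ := smul_left_injective ℂ (e.ne_zero σ₁) ((hqv _).symm.trans hc1)
    have h0 : (q : ℂ) = -c₀ := smul_left_injective ℂ (e.ne_zero σ₀) ((hqv _).symm.trans hc0)
    have hq00 : (q : ℂ) = 0 := by linear_combination (h1 + h0) / 2
    have hq0' : q = 0 := by exact_mod_cast hq00
    rw [hq, hq0', zero_smul]
  -- (2) some `X′ ∈ 𝔞` has a non-zero `E`- or `F`-component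
  obtain ⟨X', hX'𝔞, c, hc, hc12⟩ : ∃ X' ∈ 𝔞, ∃ c : Fin 3 → ℂ,
      X'.baseChange ℂ = c 0 • Θ' + c 1 • E + c 2 • F ∧ (c 1 ≠ 0 ∨ c 2 ≠ 0) := by
    by_contra hnone
    push Not at hnone
    -- then every `X′ ∈ 𝔞` is `0`, so `𝔞_ℂ = 0`, contradicting `Θ′ ∈ 𝔞_ℂ`, `Θ′ e σ₁ = e σ₁ ≠ 0`
    have hall : ∀ X' ∈ 𝔞, X' = 0 := by
      intro X' hX'
      obtain ⟨c, hc⟩ := hcoef (baseChange_mem_spanC hX')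
      obtain ⟨h1, h2⟩ := hnone X' hX' c hc
      rw [h1, h2, zero_smul, zero_smul, add_zero, add_zero] at hc
      exact hzero X' hX' (c 0) hc
    have hbot : spanC 𝔞 = ⊥ := by
      rw [spanC, Submodule.span_eq_bot]
      rintro _ ⟨X', hX', rfl⟩
      change X'.baseChange ℂ = 0
      rw [hall X' hX', LinearMap.baseChange_zero]
    have h0 : Θ' (e σ₁) = 0 := by
      have h := hΘ'𝔞
      rw [hbot, Submodule.mem_bot] at h
      rw [h, LinearMap.zero_apply]
    rw [hΘ1] at h0
    exact e.ne_zero σ₁ h0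
  -- (3) bracket twice with `Θ′`: `c₁ • E ∈ 𝔞_ℂ` and `c₂ • F ∈ 𝔞_ℂ`
  have hX'C : X'.baseChange ℂ ∈ spanC 𝔞 := baseChange_mem_spanC hX'𝔞
  have hB₁mem : (2 * c 1) • E - (2 * c 2) • F ∈ spanC 𝔞 := by
    have h := commutator_mem_spanC hbr hΘ'𝔞 hX'C
    rwa [hc, had] at h
  have hB₂mem : (2 * (2 * c 1)) • E - (2 * -(2 * c 2)) • F ∈ spanC 𝔞 := by
    have h := commutator_mem_spanC hbr hΘ'𝔞 hB₁mem
    have h' : (2 * c 1) • E - (2 * c 2) • F = (0 : ℂ) • Θ' + (2 * c 1) • E + (-(2 * c 2)) • F := by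
      module
    rwa [h', had] at h
  have hcE : (8 * c 1) • E ∈ spanC 𝔞 := by
    have h : (8 * c 1) • E = (2 : ℂ) • ((2 * c 1) • E - (2 * c 2) • F) +
        ((2 * (2 * c 1)) • E - (2 * -(2 * c 2)) • F) := by
      rw [smul_sub, smul_smul, smul_smul]; module
    rw [h]; exact Submodule.add_mem _ (Submodule.smul_mem _ _ hB₁mem) hB₂mem
  have hcF : (8 * c 2) • F ∈ spanC 𝔞 := by
    have h : (8 * c 2) • F = ((2 * (2 * c 1)) • E - (2 * -(2 * c 2)) • F) -
        (2 : ℂ) • ((2 * c 1) • E - (2 * c 2) • F) := by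
      rw [smul_sub, smul_smul, smul_smul]; module
    rw [h]; exact Submodule.sub_mem _ hB₂mem (Submodule.smul_mem _ _ hB₁mem)
  -- (4) conjugation exchanges `E` and `F`
  have hEF_iff : E ∈ spanC 𝔞 ∧ F ∈ spanC 𝔞 := by
    rcases hc12 with h1 | h2
    · have hE : E ∈ spanC 𝔞 := by
        have h := Submodule.smul_mem _ (8 * c 1)⁻¹ hcE
        rwa [smul_smul, inv_mul_cancel₀ (mul_ne_zero (by norm_num) h1), one_smul] at h
      exact ⟨hE, conjOp_mem_spanC hE fun v => (conj_projE_conj_apply H rfl e hF hFc X v).symm⟩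
    · have hF' : F ∈ spanC 𝔞 := by
        have h := Submodule.smul_mem _ (8 * c 2)⁻¹ hcF
        rwa [smul_smul, inv_mul_cancel₀ (mul_ne_zero (by norm_num) h2), one_smul] at h
      exact ⟨conjOp_mem_spanC hF' fun v => (conj_projF_conj_apply H rfl e hF hFc X v).symm, hF'⟩
  -- (5) `Lie Hg ⊗ ℂ = ℂΘ′ ⊕ ℂE ⊕ ℂF ⊆ 𝔞_ℂ`
  intro Z hZ
  obtain ⟨c', hc'⟩ := hspan hZ
  rw [hc']
  exact Submodule.add_mem _ (Submodule.add_mem _ (Submodule.smul_mem _ _ hΘ'𝔞) (Submodule.smul_mem _ _ hEF_iff.1))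
    (Submodule.smul_mem _ _ hEF_iff.2)

/-! ### §3 Theorem L′: rational tensors killed by `Θ` are killed by `Lie Hg ⊗ ℂ` -/

/-- **Theorem L′ (invariance of rational tensors under `Lie Hg ⊗ ℂ ≅ 𝔰𝔩₂`, Hodge-group rank three).**  Let `H` be an
effective polarizable `ℚ`-Hodge structure of weight `1` with `dim_ℚ Lie Hg(H) ≤ 3` and `Lie Hg(H) ⊄ End_Hdg(V)` (an abelian
variety NOT of CM type with `dim MT(H¹) ≤ 4`; Moonen–Zarhin Types I(1), II(1): `Hg = SL₂`, resp. `Hg = SL₁(D)`).  Let `q`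
be a rational coefficient tensor (letters: slots `Fin m` × a `ℚ`-basis `eQ` of `V`) killed — slice by slice, diagonally —
by the matrix of a Hodge operator `Θ` (`= 2p − 1` on `V^{p,1-p}`).  Then `q` is killed by the matrix of EVERY
`Y ∈ Lie Hg(H) ⊗ ℂ`.  Proof: the rational Lie algebra `𝔞` of `X ∈ 𝔰𝔭_{End_Hdg}(V, ψ)` killing `q` (the tree's `annLie`) is
bracket-closed and `Θ ∈ 𝔞_ℂ` by descent (`mem_spanC_annLie`, Deligne LNM 900 I §3); by the `Θ`-subalgebra theorem
`hodgeLieC_le_spanC_of_theta_mem`, `𝔞_ℂ ⊇ Lie Hg ⊗ ℂ ∋ Y`, and `𝔞_ℂ` kills `q_ℂ`.  This is the Lie-algebra step of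
Murty's theorem `Hdg(A^k) = Div(A^k)` for `rank Hg(A)_ℂ = rdim A = 1` (Gordon Thm. 7.5, §7.3.2) — the shape of the tree's
THEOREM L (`wordDerAt_eq_zero_of_mapsTo_of_skew`, the real-multiplication case).
[cite: Deligne1982HodgeCycles, I §3 (proof of Prop. 3.4)] [cite: Gordon1997, §7.3.2 and Thm. 7.5]
[cite: MoonenZarhin1999LowDim, §2] -/
theorem wordDerAt_eq_zero_of_mem_hodgeLieC_of_rankThree (H : HodgeStructure V n) (ψ : H.Polarization) (hn : n = 1)
    (hH : H.IsEffective) (hne : ¬ H.hodgeLie ≤ Subalgebra.toSubmodule H.endAlg)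
    (h3 : Module.finrank ℚ H.hodgeLie ≤ 3) {M d m : ℕ} (eQ : Module.Basis (Fin M) ℚ V)
    (q : (Fin d → Fin m × Fin M) → ℚ) {Θ : Module.End ℂ (ℂ ⊗[ℚ] V)}
    (hΘ : ∀ p, ∀ x ∈ H.piece p (n - p), Θ x = ((2 * p - n : ℤ) : ℂ) • x)
    (hΘq : ∀ u : Fin d → Fin m, wordDerAt ℂ (fun _ : Fin d =>
      LinearMap.toMatrix (Algebra.TensorProduct.basis ℂ eQ) (Algebra.TensorProduct.basis ℂ eQ) Θ)
      (wordSlice (fun w => algebraMap ℚ ℂ (q w)) u) = 0)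
    {Y : Module.End ℂ (ℂ ⊗[ℚ] V)} (hY : Y ∈ H.hodgeLieC) (u : Fin d → Fin m) :
    wordDerAt ℂ (fun _ : Fin d =>
      LinearMap.toMatrix (Algebra.TensorProduct.basis ℂ eQ) (Algebra.TensorProduct.basis ℂ eQ) Y)
      (wordSlice (fun w => algebraMap ℚ ℂ (q w)) u) = 0 := by
  -- the rational Lie algebra `𝔞 ⊆ 𝔰𝔭_E(V, ψ)` of `q`, with `E = End_Hdg(V)` itself as the commuting family
  set 𝔞 : Submodule ℚ (Module.End ℚ V) := annLie ψ.form eQ (fun a : H.endAlg => (a : Module.End ℚ V)) q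
    with h𝔞
  have hΘC : Θ ∈ H.hodgeLieC := H.mem_hodgeLieC_of_forall_piece hΘ
  have hΘ𝔞 : Θ ∈ spanC 𝔞 :=
    mem_spanC_annLie ψ.form eQ _ q hΘq (fun a => commute_baseChange_of_mem_hodgeLieC H hΘC a)
      fun x y => by rw [formBaseChange_skew_of_mem_hodgeLieC ψ hΘC, neg_add_cancel]
  have hbr : ∀ X ∈ 𝔞, ∀ X' ∈ 𝔞, X * X' - X' * X ∈ 𝔞 := fun X hX X' hX' =>
    commutator_mem_annLie ψ.form eQ _ q hX hX'
  have hcomm : ∀ X ∈ 𝔞, ∀ a : H.endAlg, X * (a : Module.End ℚ V) = (a : Module.End ℚ V) * X :=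
    fun X hX a => ((mem_annLie_iff ψ.form eQ _ q X).1 hX).2.1 a
  have hskew : ∀ X ∈ 𝔞, ∀ v w, ψ.form (X v) w + ψ.form v (X w) = 0 :=
    fun X hX => ((mem_annLie_iff ψ.form eQ _ q X).1 hX).2.2
  have hY𝔞 : Y ∈ spanC 𝔞 :=
    hodgeLieC_le_spanC_of_theta_mem H ψ hn hH hne h3 hbr hcomm hskew hΘ hΘ𝔞 hY
  rw [h𝔞] at hY𝔞
  exact wordDerAt_eq_zero_of_mem_spanC_annLie ψ.form eQ _ q hY𝔞 u

end HodgeStructure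

end Literature.AlgebraicGeometry.Motives

end
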